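import Summits.Parity.GeneralizedHardyLittlewood.Theorems.LeeYangFibresCellParityLawDefs
import Summits.Parity.GeneralizedHardyLittlewood.Theorems.LeeYangFibresCellParityLawSieveDefs
import Literature.NumberTheory.Sieve.SieveFunctions
import Literature.NumberTheory.Sieve.SieveFramework
import HarnessLib

/-!
# Route `LeeYangFibres`, crux `CellParityLaw` (stmt-Parity-14109), line `section-annihilator`:
# the bookkeeping identities `SectionSeqFacts` of the section sequences

Proof of the registered stub `stub_sectionSeqFacts : SectionSeqFacts` of skeleton v9 (elementary double
counting, no analytic input). The lattice points counted by a section mass `sectionMass … (ed)`, by the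
prime cell `C_{(1,j')}` or by the top cell `C_{(2,j')}` are classified by an index — the value
`q = ψ_i(n)/e`, the value `q = ψ_i(n)`, resp. the pair `(p₁, q) = (P⁻(ψ_i(n)), ψ_i(n)/P⁻(ψ_i(n)))` — and each
fibre is (contained in) the fibre `{ψ_i = eq}` / `{ψ_i = q}` / `{ψ_i = p₁ q}` counted by the section weight
`b`, whence:

* (a) `A_d(x) = sectionMass … (ed)` for the divisor sequence `sectionSeq … e` once `ex ≥ ψ_i` on the box;
* (b) `R_d(x) = sectionMass … (ed) - g(ed) F` for `d ≠ 0` coprime to `e` (multiplicativity of `g`);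
* (c) `C_{(1,j')} ≤ S(b, z)` for `z ≤ N^{1/u}` (a value with `P⁻ > N^{1/u} ≥ z` is coprime to `P(z)`);
* (d) `C_{(2,j')} ≤ ∑_{N^{1/2} < p ≤ M, p prime} S(b_p, z)` for `z ≤ N^{1/2}` once `M² ≥ ψ_i` on the box
  (`ψ_i(n) = p₁ q` with `p₁ = P⁻(ψ_i(n)) > N^{1/2}`, `Ω = 2` so `q` is a prime `≥ p₁`, `p₁² ≤ p₁ q ≤ M²`).
-/

noncomputable section

open scoped BigOperators Classical
open Finset Literature.NumberTheory.Sieve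

namespace Summit.Parity.GeneralizedHardyLittlewood.Cruxes.CellParityLaw.SectionAnnihilator

namespace SeqFactsAux

variable {t : ℕ} (Ψ : Fin (t + 1) → AffLinForm 1) (K : Set (Fin 1 → ℝ)) (N u : ℕ) (i : Fin (t + 1))
  (j' : Fin t → ℕ)

/-- A natural number all of whose prime factors are `≥ z` (`z ≤ P⁻(q)`) is coprime to `P(z)`. -/
theorem coprime_primesProdBelow_of_le_minFac {q : ℕ} {z : ℝ} (h : z ≤ (q.minFac : ℝ)) :
    q.Coprime (primesProdBelow z) := by
  rw [coprime_primesProdBelow_iff]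
  intro p hp hpq
  rw [Nat.mem_primesBelow] at hp
  have h1 : (q.minFac : ℝ) ≤ p := Nat.cast_le.mpr (Nat.minFac_le_of_dvd hp.2.two_le hpq)
  exact absurd (h.trans h1) (not_le.mpr (Nat.lt_ceil.mp hp.1))

/-- **Counting lemma.** A finset `S` of lattice points of the box, each in `K` with frozen other forms
and with `ψ_i(n) = g (f n)` for an index `f n ∈ T`, has at most `∑_{b ∈ T} b(g b)` elements: classify
its points by `f`; the fibre at `b` lies in the fibre `{ψ_i = g b}` counted by the section weight. -/
theorem card_le_sum_sectionWeight {β : Type*} (S : Finset (Fin 1 → ℤ)) (T : Finset β) (g : β → ℕ)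
    (f : (Fin 1 → ℤ) → β) (hf : ∀ n ∈ S, f n ∈ T)
    (hS : ∀ n ∈ S, n ∈ latticeBox 1 N ∧ realPoint n ∈ K ∧ (Ψ i).eval n = ((g (f n) : ℕ) : ℤ) ∧
      ∀ k : Fin t, (N : ℝ) ^ ((1 : ℝ) / u) < (Nat.minFac ((Ψ (i.succAbove k)).eval n).toNat : ℝ) ∧
        ArithmeticFunction.cardFactors ((Ψ (i.succAbove k)).eval n).toNat = j' k) :
    S.card ≤ ∑ b ∈ T, sectionWeight Ψ K N u i j' (g b) := by
  rw [Finset.card_eq_sum_card_fiberwise (f := f) (t := T) fun n hn => hf n hn]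
  refine Finset.sum_le_sum fun b _ => ?_
  unfold sectionWeight
  refine Finset.card_le_card fun n hn => ?_
  rw [Finset.mem_filter] at hn ⊢
  obtain ⟨hnS, rfl⟩ := hn
  exact hS n hnS

/-- **(a), over `ℕ`.** Once `e x ≥ ψ_i` on the box (`e ≥ 1`), `∑_{0 < q ≤ x, d ∣ q} b(eq)` is the section
mass at the modulus `ed`: classify the points of the latter by `q = ψ_i(n)/e`; the fibre at `q` IS the
fibre `{ψ_i = eq}` of the section weight. (`d = 0` is allowed: both sides vanish.) -/
theorem sum_sectionWeight_eq_sectionMass {e : ℕ} {x : ℝ} (he : 1 ≤ e)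
    (hx : ∀ n ∈ latticeBox 1 N, (((Ψ i).eval n : ℤ) : ℝ) ≤ e * x) (d : ℕ) (T : Finset ℕ)
    (hT : ∀ q, q ∈ T ↔ (0 < q ∧ q ≤ ⌊x⌋₊) ∧ d ∣ q) :
    ∑ q ∈ T, sectionWeight Ψ K N u i j' (e * q) = sectionMass Ψ K N u i j' (e * d) := by
  have he0 : 0 < e := he
  unfold sectionMass
  rw [Finset.card_eq_sum_card_fiberwise (f := fun n => ((Ψ i).eval n).toNat / e) (t := T)]
  · refine Finset.sum_congr rfl fun q hq => ?_
    obtain ⟨⟨hq0, -⟩, hdq⟩ := (hT q).mp hq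
    unfold sectionWeight
    congr 1
    ext n
    simp only [Finset.mem_filter]
    constructor
    · rintro ⟨hbox, hK, hev, hfr⟩
      refine ⟨⟨hbox, hK, ?_, ?_, hfr⟩, ?_⟩
      · rw [hev]
        exact_mod_cast Nat.mul_pos he0 hq0
      · rw [hev]
        exact Int.natCast_dvd_natCast.mpr (Nat.mul_dvd_mul_left e hdq)
      · rw [hev, Int.toNat_natCast, Nat.mul_div_cancel_left q he0]
    · rintro ⟨⟨hbox, hK, hpos, hdvd, hfr⟩, hfq⟩
      refine ⟨hbox, hK, ?_, hfr⟩
      obtain ⟨m, hm⟩ := Int.eq_ofNat_of_zero_le hpos.le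
      rw [hm, Int.toNat_natCast] at hfq
      rw [hm] at hdvd
      have hem : e ∣ m := (Nat.dvd_mul_right e d).trans (Int.natCast_dvd_natCast.mp hdvd)
      rw [hm, ← hfq, Nat.mul_div_cancel' hem]
  · intro n hn
    rw [Finset.mem_coe, Finset.mem_filter] at hn
    obtain ⟨hbox, -, hpos, hdvd, -⟩ := hn
    obtain ⟨m, hm⟩ := Int.eq_ofNat_of_zero_le hpos.le
    have hxn := hx n hbox
    rw [hm] at hdvd hpos hxn
    rw [Int.cast_natCast] at hxn
    have hed : e * d ∣ m := Int.natCast_dvd_natCast.mp hdvd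
    have hem : e ∣ m := (Nat.dvd_mul_right e d).trans hed
    have hmq : e * (m / e) = m := Nat.mul_div_cancel' hem
    have hm0 : 0 < m := by exact_mod_cast hpos
    show ((Ψ i).eval n).toNat / e ∈ T
    rw [hm, Int.toNat_natCast, hT]
    refine ⟨⟨Nat.div_pos (Nat.le_of_dvd hm0 hem) he0, Nat.le_floor ?_⟩, ?_⟩
    · refine le_of_mul_le_mul_left ?_ (Nat.cast_pos.mpr he0 : (0 : ℝ) < e)
      calc (e : ℝ) * ((m / e : ℕ) : ℝ) = ((e * (m / e) : ℕ) : ℝ) := by push_cast; ring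
        _ = m := by rw [hmq]
        _ ≤ e * x := hxn
    · rw [← hmq] at hed
      exact Nat.dvd_of_mul_dvd_mul_left he0 hed

/-- **(c), over `ℕ`.** The prime cell `C_{(1,j')}` is at most `∑_{0 < q ≤ x, (q, P(z)) = 1} b(q)` for
`z ≤ N^{1/u}` once `x ≥ ψ_i` on the box: a point of the cell has `ψ_i(n) = q` with `Ω(q) = 1` (so
`q ≥ 2`, `ψ_i(n) > 0`) and `P⁻(q) > N^{1/u} ≥ z`, so `q` is coprime to `P(z)`. -/
theorem cell_one_le_sum {x z : ℝ} (hx : ∀ n ∈ latticeBox 1 N, (((Ψ i).eval n : ℤ) : ℝ) ≤ x)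
    (hzN : z ≤ (N : ℝ) ^ ((1 : ℝ) / u)) (T : Finset ℕ)
    (hT : ∀ q, q ∈ T ↔ (0 < q ∧ q ≤ ⌊x⌋₊) ∧ q.Coprime (primesProdBelow z)) :
    cell Ψ K N u (i.insertNth 1 j') ≤ ∑ q ∈ T, sectionWeight Ψ K N u i j' (1 * q) := by
  unfold cell
  refine card_le_sum_sectionWeight Ψ K N u i j' _ T (fun q => 1 * q)
    (fun n => ((Ψ i).eval n).toNat) ?_ ?_
  · intro n hn
    rw [Finset.mem_filter] at hn
    obtain ⟨hbox, -, hall⟩ := hn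
    obtain ⟨hrough, hΩ⟩ := hall i
    rw [Fin.insertNth_apply_same] at hΩ
    have h1 : 1 < ((Ψ i).eval n).toNat :=
      ArithmeticFunction.cardFactors_pos_iff_one_lt.mp (by rw [hΩ]; exact Nat.one_pos)
    have h2 : ((((Ψ i).eval n).toNat : ℕ) : ℤ) = (Ψ i).eval n := by omega
    have hxn := hx n hbox
    rw [← h2, Int.cast_natCast] at hxn
    rw [hT]
    exact ⟨⟨by omega, Nat.le_floor hxn⟩, coprime_primesProdBelow_of_le_minFac (hzN.trans hrough.le)⟩
  · intro n hn
    rw [Finset.mem_filter] at hn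
    obtain ⟨hbox, hK, hall⟩ := hn
    refine ⟨hbox, hK, ?_, fun k => ?_⟩
    · obtain ⟨-, hΩ⟩ := hall i
      rw [Fin.insertNth_apply_same] at hΩ
      have h1 : 1 < ((Ψ i).eval n).toNat :=
        ArithmeticFunction.cardFactors_pos_iff_one_lt.mp (by rw [hΩ]; exact Nat.one_pos)
      rw [one_mul]
      omega
    · have hk := hall (i.succAbove k)
      rw [Fin.insertNth_apply_succAbove] at hk
      exact hk

/-- **(d), over `ℕ`.** The top cell `C_{(2,j')}` at `u = 2` is at most `∑_p ∑_q b(pq)` over the primes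
`N^{1/2} < p ≤ M` and the `0 < q ≤ x` coprime to `P(z)`, for `z ≤ N^{1/2}`, once `x ≥ ψ_i` and `M² ≥ ψ_i`
on the box: a point of the cell has `ψ_i(n) = p₁ q` with `p₁ = P⁻(ψ_i(n)) > N^{1/2}` prime and
`Ω(q) = 2 - 1 = 1`, so `q` is a prime `≥ p₁ ≥ z` (coprime to `P(z)`) and `p₁² ≤ p₁ q ≤ M²`. -/
theorem cell_two_le_sum {x z : ℝ} {M : ℕ} (hx : ∀ n ∈ latticeBox 1 N, (((Ψ i).eval n : ℤ) : ℝ) ≤ x)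
    (hM : ∀ n ∈ latticeBox 1 N, (Ψ i).eval n ≤ (M : ℤ) ^ 2) (hzN : z ≤ (N : ℝ) ^ ((1 : ℝ) / 2))
    (P T : Finset ℕ)
    (hP : ∀ p, p ∈ P ↔ (1 ≤ p ∧ p ≤ M) ∧ p.Prime ∧ (N : ℝ) ^ ((1 : ℝ) / 2) < (p : ℝ))
    (hT : ∀ q, q ∈ T ↔ (0 < q ∧ q ≤ ⌊x⌋₊) ∧ q.Coprime (primesProdBelow z)) :
    cell Ψ K N 2 (i.insertNth 2 j') ≤ ∑ p ∈ P, ∑ q ∈ T, sectionWeight Ψ K N 2 i j' (p * q) := by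
  rw [← Finset.sum_product']
  unfold cell
  refine card_le_sum_sectionWeight Ψ K N 2 i j' _ (P ×ˢ T) (fun pq => pq.1 * pq.2)
    (fun n => (((Ψ i).eval n).toNat.minFac, ((Ψ i).eval n).toNat / ((Ψ i).eval n).toNat.minFac))
    ?_ ?_
  · intro n hn
    rw [Finset.mem_filter] at hn
    obtain ⟨hbox, -, hall⟩ := hn
    obtain ⟨hrough, hΩ⟩ := hall i
    rw [Fin.insertNth_apply_same] at hΩ
    rw [Nat.cast_ofNat] at hrough
    have h1 : 1 < ((Ψ i).eval n).toNat :=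
      ArithmeticFunction.cardFactors_pos_iff_one_lt.mp (by rw [hΩ]; exact Nat.two_pos)
    have hveq : ((((Ψ i).eval n).toNat : ℕ) : ℤ) = (Ψ i).eval n := by omega
    generalize hv : ((Ψ i).eval n).toNat = v at hrough hΩ h1 hveq ⊢
    have hv1 : v ≠ 1 := by omega
    have hv0 : v ≠ 0 := by omega
    have hp₁ : v.minFac.Prime := Nat.minFac_prime hv1
    have hpq : v.minFac * (v / v.minFac) = v := Nat.mul_div_cancel' (Nat.minFac_dvd v)
    have hq0 : v / v.minFac ≠ 0 := fun h => hv0 (by rw [← hpq, h, mul_zero])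
    have hqprime : (v / v.minFac).Prime := by
      rw [← ArithmeticFunction.cardFactors_eq_one_iff_prime]
      have hmul := ArithmeticFunction.cardFactors_mul hp₁.ne_zero hq0
      rw [hpq, hΩ, ArithmeticFunction.cardFactors_apply_prime hp₁] at hmul
      omega
    have hle : v.minFac ≤ v / v.minFac :=
      Nat.minFac_le_of_dvd hqprime.two_le (Nat.div_dvd_of_dvd (Nat.minFac_dvd v))
    rw [Finset.mem_product, hP, hT]
    refine ⟨⟨⟨hp₁.one_lt.le, ?_⟩, hp₁, hrough⟩, ⟨Nat.pos_of_ne_zero hq0, Nat.le_floor ?_⟩,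
      coprime_primesProdBelow_of_le_minFac ?_⟩
    · have hvM : v ≤ M ^ 2 := by
        have h := hM n hbox
        rw [← hveq] at h
        exact_mod_cast h
      refine Nat.mul_self_le_mul_self_iff.mp ?_
      calc v.minFac * v.minFac ≤ v.minFac * (v / v.minFac) := Nat.mul_le_mul_left _ hle
        _ = v := hpq
        _ ≤ M * M := by rw [← pow_two]; exact hvM
    · have hxn := hx n hbox
      rw [← hveq, Int.cast_natCast] at hxn
      exact le_trans (Nat.cast_le.mpr (Nat.div_le_self _ _)) hxn
    · rw [hqprime.minFac_eq]
      exact hzN.trans (hrough.le.trans (Nat.cast_le.mpr hle))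
  · intro n hn
    rw [Finset.mem_filter] at hn
    obtain ⟨hbox, hK, hall⟩ := hn
    refine ⟨hbox, hK, ?_, fun k => ?_⟩
    · obtain ⟨-, hΩ⟩ := hall i
      rw [Fin.insertNth_apply_same] at hΩ
      have h1 : 1 < ((Ψ i).eval n).toNat :=
        ArithmeticFunction.cardFactors_pos_iff_one_lt.mp (by rw [hΩ]; exact Nat.two_pos)
      rw [Nat.mul_div_cancel' (Nat.minFac_dvd _)]
      omega
    · have hk := hall (i.succAbove k)
      rw [Fin.insertNth_apply_succAbove] at hk
      exact hk

end SeqFactsAux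

open SeqFactsAux in
/-- **`stub_sectionSeqFacts`** (registered stub of skeleton v9, line `section-annihilator`): the
bookkeeping identities `SectionSeqFacts` of the section sequences — (a) congruence sums of the divisor
sequence `sectionSeq … e` are section masses at the moduli `ed`; (b) hence its remainders at `d ≠ 0`
coprime to `e` are the atom's discrepancies at `ed` (multiplicativity of the section density); (c) the
prime cell is at most the sifted mass `S(b, z)`; (d) at `u = 2` the top cell is at most the total sifted
mass of the divisor sequences `b_p`, `N^{1/2} < p ≤ M` prime. Elementary double counting
(`SeqFactsAux.card_le_sum_sectionWeight`). -/
theorem stub_sectionSeqFacts : SectionSeqFacts := by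
  intro t Ψ K N u i j'
  have hA : ∀ (e : ℕ) (x : ℝ), 1 ≤ e → (∀ n ∈ latticeBox 1 N, (((Ψ i).eval n : ℤ) : ℝ) ≤ e * x) →
      ∀ d : ℕ, (sectionSeq Ψ K N u i j' e).congrSum d x = sectionMass Ψ K N u i j' (e * d) := by
    intro e x he hx d
    rw [SieveSequence.congrSum, ← sum_sectionWeight_eq_sectionMass Ψ K N u i j' he hx d
      ((Ioc 0 ⌊x⌋₊).filter (d ∣ ·)) (fun q => by rw [Finset.mem_filter, Finset.mem_Ioc]),
      Nat.cast_sum]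
    rfl
  refine ⟨hA, ?_, ?_, ?_⟩
  · intro e x he hx d hd hed
    rw [SieveSequence.remainder, hA e x he hx d]
    have he0 : e ≠ 0 := by omega
    have hmul : sectionDensity Ψ i (e * d) = sectionDensity Ψ i e * sectionDensity Ψ i d := by
      rw [← sectionDensityFn_apply Ψ i (mul_ne_zero he0 hd), ← sectionDensityFn_apply Ψ i he0,
        ← sectionDensityFn_apply Ψ i hd]
      exact (isMultiplicative_sectionDensityFn Ψ i).map_mul_of_coprime hed
    show (sectionMass Ψ K N u i j' (e * d) : ℝ) -
        sectionDensityFn Ψ i d * (sectionDensity Ψ i e * (sectionMass Ψ K N u i j' 1 : ℝ)) = _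
    rw [sectionDensityFn_apply Ψ i hd, hmul]
    ring
  · intro x z _hu hx _hz hzN
    rw [SieveSequence.sifted]
    have key := cell_one_le_sum Ψ K N u i j' hx hzN
      ((Ioc 0 ⌊x⌋₊).filter (fun q : ℕ => q.Coprime (primesProdBelow z)))
      (fun q => by rw [Finset.mem_filter, Finset.mem_Ioc])
    calc (cell Ψ K N u (i.insertNth 1 j') : ℝ)
        ≤ ((∑ q ∈ (Ioc 0 ⌊x⌋₊).filter (fun q : ℕ => q.Coprime (primesProdBelow z)),
            sectionWeight Ψ K N u i j' (1 * q) : ℕ) : ℝ) := Nat.cast_le.mpr key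
      _ = _ := by rw [Nat.cast_sum]; rfl
  · intro x z M _hu hx hM _hz hzN
    simp only [SieveSequence.sifted]
    have key := cell_two_le_sum Ψ K N i j' hx hM hzN
      ((Finset.Icc 1 M).filter (fun p : ℕ => p.Prime ∧ (N : ℝ) ^ ((1 : ℝ) / 2) < (p : ℝ)))
      ((Ioc 0 ⌊x⌋₊).filter (fun q : ℕ => q.Coprime (primesProdBelow z)))
      (fun p => by rw [Finset.mem_filter, Finset.mem_Icc])
      (fun q => by rw [Finset.mem_filter, Finset.mem_Ioc])
    calc (cell Ψ K N 2 (i.insertNth 2 j') : ℝ)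
        ≤ ((∑ p ∈ (Finset.Icc 1 M).filter
              (fun p : ℕ => p.Prime ∧ (N : ℝ) ^ ((1 : ℝ) / 2) < (p : ℝ)),
            ∑ q ∈ (Ioc 0 ⌊x⌋₊).filter (fun q : ℕ => q.Coprime (primesProdBelow z)),
              sectionWeight Ψ K N 2 i j' (p * q) : ℕ) : ℝ) := Nat.cast_le.mpr key
      _ = _ := by simp only [Nat.cast_sum]; rfl

end Summit.Parity.GeneralizedHardyLittlewood.Cruxes.CellParityLaw.SectionAnnihilator

end
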